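import Summits.RiemannHypothesis.RiemannHypothesis.Theorems.Splittings.JensenDegenerateCriticalDefs

/-!
# Splittings / Jensen — the DEGENERATE-CRITICAL-POINT witness `G_{c,K}` — FILE 2/4: CORE (§1–§5)

Carve of `HOME/rh-split-jen-neg/g8/stage/JensenDegenerateCritical.lean` (6de8f964827225eb); definitions and the full
mathematical header live in `JensenDegenerateCriticalDefs.lean`; declaration blocks byte-identical to the stage file.

Contents: §1 the ODE `4w·C″ + 2C′ = C` of `cosh √·`; §2 `G′ = (w + c)²·cosh √w` and `G″`; §3 values on the negative
real axis (origin, sea points, `-c`); §4 reality on the real axis; §5 `G` entire of order `< 1` (exponent `3/4`).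
-/

set_option linter.dupNamespace false

namespace Summit.RiemannHypothesis.RiemannHypothesis.Theorems.Splittings.JensenDegenerateCritical

open Complex
open scoped Real ComplexConjugate Nat
open Literature.Barriers.RiemannHypothesis
open Literature.NumberTheory.LFunctions (jensenPoly exists_sq_eq iteratedDeriv_conj_of_conj)
open Literature.Analysis.TotalPositivity (IsEntireOfOrderLtOne)
open Literature.Analysis.Complex (IsEntireOfOrderLt HasNoFourierCriticalPoint)
open Summit.RiemannHypothesis.RiemannHypothesis.Theorems.Splittings.JensenMixedSplit

/-! ## §1 The second-order ODE of `cosh √·` -/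

/-- `4 w C''(w) + 2 C'(w) = C(w)` for `C = cosh √·` (differentiate `2u·C'(u²) = sinh u`). -/
theorem coshSqrt_ode (w : ℂ) :
    4 * w * deriv (deriv coshSqrt) w + 2 * deriv coshSqrt w = coshSqrt w := by
  obtain ⟨u, rfl⟩ := exists_sq_eq w
  have hφ : (fun v : ℂ ↦ deriv coshSqrt (v ^ 2) * (2 * v)) = Complex.sinh :=
    funext deriv_coshSqrt_sq_mul
  have h1 : HasDerivAt (fun v : ℂ ↦ deriv coshSqrt (v ^ 2))
      (deriv (deriv coshSqrt) (u ^ 2) * (2 * u)) u := by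
    have ha : HasDerivAt (deriv coshSqrt) (deriv (deriv coshSqrt) (u ^ 2)) (u ^ 2) :=
      (differentiable_deriv_coshSqrt _).hasDerivAt
    have hb : HasDerivAt (fun v : ℂ ↦ v ^ 2) (2 * u) u := by simpa using hasDerivAt_pow 2 u
    exact ha.comp u hb
  have h2 : HasDerivAt (fun v : ℂ ↦ 2 * v) 2 u := by
    simpa using (hasDerivAt_id u).const_mul (2 : ℂ)
  have h3 : HasDerivAt (fun v : ℂ ↦ deriv coshSqrt (v ^ 2) * (2 * v))
      (deriv (deriv coshSqrt) (u ^ 2) * (2 * u) * (2 * u) + deriv coshSqrt (u ^ 2) * 2) u :=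
    h1.mul h2
  rw [hφ] at h3
  have h4 := h3.unique (Complex.hasDerivAt_sinh u)
  rw [← coshSqrt_sq] at h4
  linear_combination h4

/-! ## §2 The witness `G_{c,K}` and its derivative -/

/-- Derivative of the quadratic `q₁ c`. -/
theorem hasDerivAt_q₁ (c : ℝ) (w : ℂ) : HasDerivAt (q₁ c) (2 * w + (2 * c + 20)) w := by
  have h1 : HasDerivAt (fun w : ℂ ↦ w ^ 2) (2 * w) w := by simpa using hasDerivAt_pow 2 w
  have h2 : HasDerivAt (fun w : ℂ ↦ (2 * (c : ℂ) + 20) * w) (2 * (c : ℂ) + 20) w := by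
    simpa using (hasDerivAt_id w).const_mul (2 * (c : ℂ) + 20)
  exact (h1.add h2).add_const _

/-- Derivative of the quadratic `q₂ c`. -/
theorem hasDerivAt_q₂ (c : ℝ) (w : ℂ) : HasDerivAt (q₂ c) (10 * w + (6 * c + 60)) w := by
  have h1 : HasDerivAt (fun w : ℂ ↦ (5 : ℂ) * w ^ 2) (5 * (2 * w)) w := by
    simpa using (hasDerivAt_pow 2 w).const_mul (5 : ℂ)
  have h2 : HasDerivAt (fun w : ℂ ↦ (6 * (c : ℂ) + 60) * w) (6 * (c : ℂ) + 60) w := by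
    simpa using (hasDerivAt_id w).const_mul (6 * (c : ℂ) + 60)
  have h := (h1.add h2).add_const ((c : ℂ) ^ 2 + 12 * c + 120)
  refine h.congr_deriv ?_
  ring

/-- **The design identity** `G'(w) = (w + c)² · cosh √w`. -/
theorem hasDerivAt_G (c K : ℝ) (w : ℂ) : HasDerivAt (G c K) ((w + c) ^ 2 * coshSqrt w) w := by
  have hC : HasDerivAt coshSqrt (deriv coshSqrt w) w := (differentiable_coshSqrt w).hasDerivAt
  have hD : HasDerivAt (deriv coshSqrt) (deriv (deriv coshSqrt) w) w :=
    (differentiable_deriv_coshSqrt w).hasDerivAt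
  have h4w : HasDerivAt (fun w : ℂ ↦ (4 : ℂ) * w) 4 w := by
    simpa using (hasDerivAt_id w).const_mul (4 : ℂ)
  have hA := ((h4w.mul hD).mul (hasDerivAt_q₁ c w)).const_add (K : ℂ)
  have hB := (hC.const_mul (2 : ℂ)).mul (hasDerivAt_q₂ c w)
  have hG : HasDerivAt (G c K) _ w := hA.sub hB
  refine hG.congr_deriv ?_
  have hode := coshSqrt_ode w
  simp only [q₁, q₂, Pi.mul_apply]
  linear_combination (w ^ 2 + (2 * (c : ℂ) + 20) * w + ((c : ℂ) ^ 2 + 12 * c + 120)) * hode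

/-- `G' (w) = (w + c)² · cosh √w` (the design identity, `deriv` form). -/
theorem deriv_G (c K : ℝ) (w : ℂ) : deriv (G c K) w = (w + c) ^ 2 * coshSqrt w :=
  (hasDerivAt_G c K w).deriv

/-- `G'` is the tree's mixed-split family `F_{c,ε}` at `ε = 0`. -/
theorem deriv_G_eq_Fw (c K : ℝ) :
    deriv (G c K) = fun w : ℂ ↦ ((w + c) ^ 2 + ((0 : ℝ) : ℂ) ^ 2) * coshSqrt w := by
  funext w; rw [deriv_G]; push_cast; ring

/-- `G c K` is entire. -/
theorem differentiable_G (c K : ℝ) : Differentiable ℂ (G c K) := fun w ↦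
  (hasDerivAt_G c K w).differentiableAt

/-- Second derivative of `G c K` (product rule on `(w + c)² · cosh √w`). -/
theorem deriv_deriv_G (c K : ℝ) (w : ℂ) :
    deriv (deriv (G c K)) w = 2 * (w + c) * coshSqrt w + (w + c) ^ 2 * deriv coshSqrt w := by
  rw [deriv_G_eq_Fw, deriv_Fw]; push_cast; ring

/-! ## §3 Values on the negative real axis -/

/-- `-t² = (t·I)²` in `ℂ`. -/
theorem neg_sq_eq (t : ℝ) : (-(t : ℂ) ^ 2) = ((t : ℂ) * I) ^ 2 := by
  rw [mul_pow, I_sq]; ring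

/-- `cosh √(-t²) = cos t`. -/
theorem coshSqrt_neg_sq (t : ℝ) : coshSqrt (-(t : ℂ) ^ 2) = (Real.cos t : ℂ) := by
  rw [neg_sq_eq, coshSqrt_sq, Complex.cosh_mul_I, Complex.ofReal_cos]

/-- `(cosh √·)'(-t²) = sin t / (2t)` for `t ≠ 0`. -/
theorem deriv_coshSqrt_neg_sq {t : ℝ} (ht : t ≠ 0) :
    deriv coshSqrt (-(t : ℂ) ^ 2) = ((Real.sin t / (2 * t) : ℝ) : ℂ) := by
  have h1 := deriv_coshSqrt_sq_mul ((t : ℂ) * I)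
  rw [Complex.sinh_mul_I, ← neg_sq_eq] at h1
  have hne : (2 * ((t : ℂ) * I)) ≠ 0 := by simp [ht, I_ne_zero]
  have h2 : deriv coshSqrt (-(t : ℂ) ^ 2) = Complex.sin t * I / (2 * ((t : ℂ) * I)) := by
    rw [← h1, mul_div_cancel_right₀ _ hne]
  rw [h2]
  have ht' : (t : ℂ) ≠ 0 := Complex.ofReal_ne_zero.2 ht
  push_cast
  field_simp

/-- Value at the origin: `G c K 0 = K - 2(c² + 12c + 120)`. -/
theorem G_zero (c K : ℝ) : G c K 0 = ((K - 2 * (c ^ 2 + 12 * c + 120) : ℝ) : ℂ) := by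
  simp only [G, q₁, q₂, coshSqrt_zero]; push_cast; ring

/-- `G(-t²) = K - 2 t sin t · Q₁(t) - 2 cos t · Q₂(t)` with `Q₁(t) = q₁(-t²)`, `Q₂(t) = q₂(-t²)`. -/
theorem G_neg_sq (c K : ℝ) {t : ℝ} (ht : t ≠ 0) :
    G c K (-(t : ℂ) ^ 2) = ((K - 2 * t * Real.sin t * (t ^ 4 - (2 * c + 20) * t ^ 2 + (c ^ 2 + 12 * c + 120))
      - 2 * Real.cos t * (5 * t ^ 4 - (6 * c + 60) * t ^ 2 + (c ^ 2 + 12 * c + 120)) : ℝ) : ℂ) := by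
  simp only [G, q₁, q₂, coshSqrt_neg_sq, deriv_coshSqrt_neg_sq ht]
  have ht' : (t : ℂ) ≠ 0 := Complex.ofReal_ne_zero.2 ht
  push_cast
  field_simp
  ring

/-- `G''(-t²) = (c - t²)² · sin t / (2t)` for `t ≠ 0`. -/
theorem deriv_deriv_G_neg_sq (c K : ℝ) {t : ℝ} (ht : t ≠ 0) :
    deriv (deriv (G c K)) (-(t : ℂ) ^ 2) =
      (((c - t ^ 2) ^ 2 * (Real.sin t / (2 * t)) + 2 * (c - t ^ 2) * Real.cos t : ℝ) : ℂ) := by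
  rw [deriv_deriv_G, coshSqrt_neg_sq, deriv_coshSqrt_neg_sq ht]; push_cast; ring

/-- The sea points `t_j = (2j+1)π/2`: `cos t_j = 0`, `sin t_j = (-1)^j`, `t_j > 0`. -/
theorem cos_sea (j : ℕ) : Real.cos ((2 * j + 1) * Real.pi / 2) = 0 :=
  Real.cos_eq_zero_iff.2 ⟨j, by push_cast; ring⟩

/-- `sin((2j+1)π/2) = (-1)^j`. -/
theorem sin_sea (j : ℕ) : Real.sin ((2 * j + 1) * Real.pi / 2) = (-1) ^ j := by
  rw [show (2 * (j : ℝ) + 1) * Real.pi / 2 = j * Real.pi + Real.pi / 2 by ring,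
    Real.sin_add_pi_div_two, Real.cos_nat_mul_pi]

/-- The sea abscissa `(2j+1)π/2` is positive. -/
theorem sea_pos (j : ℕ) : 0 < (2 * (j : ℝ) + 1) * Real.pi / 2 := by positivity

/-- `π/2 ≤ (2j+1)π/2`. -/
theorem pi_div_two_le_sea (j : ℕ) : Real.pi / 2 ≤ (2 * (j : ℝ) + 1) * Real.pi / 2 := by
  have : (0 : ℝ) ≤ j := Nat.cast_nonneg j
  nlinarith [Real.pi_pos]

/-- `G(s_j) = K - 2 (-1)^j t_j Q₁(t_j)` at the sea point `s_j = -t_j²`. -/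
theorem G_sea (c K : ℝ) (j : ℕ) :
    G c K (-(((2 * j + 1) * Real.pi / 2 : ℝ) : ℂ) ^ 2) =
      ((K - 2 * (-1) ^ j * ((2 * j + 1) * Real.pi / 2) * (((2 * j + 1) * Real.pi / 2) ^ 4
        - (2 * c + 20) * ((2 * j + 1) * Real.pi / 2) ^ 2 + (c ^ 2 + 12 * c + 120)) : ℝ) : ℂ) := by
  rw [G_neg_sq c K (sea_pos j).ne', cos_sea, sin_sea]; push_cast; ring

/-- `G''(s_j) = (c + t_j²... )`: `G''(s_j) = (c - t_j²)² (-1)^j / (2 t_j)`. -/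
theorem deriv_deriv_G_sea (c K : ℝ) (j : ℕ) :
    deriv (deriv (G c K)) (-(((2 * j + 1) * Real.pi / 2 : ℝ) : ℂ) ^ 2) =
      (((c - ((2 * j + 1) * Real.pi / 2) ^ 2) ^ 2 * ((-1) ^ j / (2 * ((2 * j + 1) * Real.pi / 2))) : ℝ) : ℂ) := by
  rw [deriv_deriv_G_neg_sq c K (sea_pos j).ne', cos_sea, sin_sea]; push_cast; ring

/-- `G'` vanishes at `-c` and at every sea point; `G''(-c) = 0`. -/
theorem deriv_G_neg_c (c K : ℝ) : deriv (G c K) (-(c : ℂ)) = 0 := by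
  rw [deriv_G]; ring

/-- `G'' (-c) = 0`: the critical point `-c` is degenerate. -/
theorem deriv_deriv_G_neg_c (c K : ℝ) : deriv (deriv (G c K)) (-(c : ℂ)) = 0 := by
  rw [deriv_deriv_G]; ring

/-- `G'` vanishes at every sea point `-((2j+1)π/2)²`. -/
theorem deriv_G_sea (c K : ℝ) (j : ℕ) :
    deriv (G c K) (-(((2 * j + 1) * Real.pi / 2 : ℝ) : ℂ) ^ 2) = 0 := by
  rw [deriv_G, coshSqrt_neg_sq, cos_sea]; push_cast; ring

/-! ## §4 Reality on the real axis -/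

/-- `(cosh √·)'` is real: `C'(conj w) = conj (C'(w))`. -/
theorem deriv_coshSqrt_conj (w : ℂ) : deriv coshSqrt (conj w) = conj (deriv coshSqrt w) := by
  obtain ⟨u, rfl⟩ := exists_sq_eq w
  rw [show conj (u ^ 2) = (conj u) ^ 2 from map_pow _ _ _]
  rcases eq_or_ne u 0 with rfl | hu
  · have h12 : deriv coshSqrt 0 = ((1 / 2 : ℝ) : ℂ) := by rw [deriv_coshSqrt_zero]; push_cast; ring
    simp only [map_zero, ne_eq, OfNat.ofNat_ne_zero, not_false_eq_true, zero_pow, h12, Complex.conj_ofReal]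
  · have h1 := deriv_coshSqrt_sq_mul (conj u)
    have h2 : conj (deriv coshSqrt (u ^ 2) * (2 * u)) = conj (deriv coshSqrt (u ^ 2)) * (2 * conj u) := by
      rw [map_mul, map_mul, Complex.conj_ofNat]
    rw [Complex.sinh_conj, ← deriv_coshSqrt_sq_mul u, h2] at h1
    have hu' : conj u ≠ 0 := (map_ne_zero _).2 hu
    have hne : (2 : ℂ) * conj u ≠ 0 := mul_ne_zero two_ne_zero hu'
    exact mul_right_cancel₀ hne h1

/-- `q₁ c` commutes with complex conjugation (real coefficients). -/
theorem q₁_conj (c : ℝ) (w : ℂ) : q₁ c (conj w) = conj (q₁ c w) := by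
  simp only [q₁, map_add, map_mul, map_pow, Complex.conj_ofReal, Complex.conj_ofNat]

/-- `q₂ c` commutes with complex conjugation (real coefficients). -/
theorem q₂_conj (c : ℝ) (w : ℂ) : q₂ c (conj w) = conj (q₂ c w) := by
  simp only [q₂, map_add, map_mul, map_pow, Complex.conj_ofReal, Complex.conj_ofNat]

/-- `G` is real: `G(conj w) = conj (G w)`. -/
theorem G_conj (c K : ℝ) (w : ℂ) : G c K (conj w) = conj (G c K w) := by
  simp only [G, q₁_conj, q₂_conj, coshSqrt_conj, deriv_coshSqrt_conj, map_add, map_sub, map_mul,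
    Complex.conj_ofReal, Complex.conj_ofNat]

/-- `G c K` is real on the real axis. -/
theorem G_im_ofReal (c K : ℝ) (x : ℝ) : (G c K x).im = 0 := by
  have h := G_conj c K x
  rw [Complex.conj_ofReal] at h
  exact Complex.conj_eq_iff_im.1 h.symm

/-- Every derivative of `G c K` is real on the real axis. -/
theorem im_iteratedDeriv_G_ofReal (c K : ℝ) (m : ℕ) (x : ℝ) : (iteratedDeriv m (G c K) x).im = 0 :=
  Literature.Analysis.Complex.im_iteratedDeriv_ofReal (differentiable_G c K) (G_im_ofReal c K) m x

/-- On the real axis `G = 0 ↔ Re G = 0`. -/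
theorem G_ofReal_eq_zero_iff (c K : ℝ) (x : ℝ) : G c K x = 0 ↔ (G c K x).re = 0 := by
  constructor
  · intro h; rw [h]; rfl
  · intro h; exact Complex.ext h (by rw [G_im_ofReal]; rfl)

/-- On the real axis `G^{(m)} = 0 ↔ Re G^{(m)} = 0`. -/
theorem iteratedDeriv_G_ofReal_eq_zero_iff (c K : ℝ) (m : ℕ) (x : ℝ) :
    iteratedDeriv m (G c K) x = 0 ↔ (iteratedDeriv m (G c K) x).re = 0 := by
  constructor
  · intro h; rw [h]; rfl
  · intro h; exact Complex.ext h (by rw [im_iteratedDeriv_G_ofReal]; rfl)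

/-! ## §5 Growth: `G` is entire of order `< 1` (exponent `3/4`) -/

/-- Elementary growth bound `(1 + s²)³ ≤ 799·e^s` for `s ≥ 0`. -/
theorem cube_le_exp {s : ℝ} (hs : 0 ≤ s) : (1 + s ^ 2) ^ 3 ≤ 799 * Real.exp s := by
  have h1 : 1 ≤ Real.exp s := Real.one_le_exp hs
  have h2 : s ^ 2 ≤ 2 * Real.exp s := by
    have := Real.pow_div_factorial_le_exp s hs 2
    rw [show ((2 : ℕ)! : ℝ) = 2 by norm_num [Nat.factorial], div_le_iff₀ (by norm_num)] at this
    linarith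
  have h4 : s ^ 4 ≤ 24 * Real.exp s := by
    have := Real.pow_div_factorial_le_exp s hs 4
    rw [show ((4 : ℕ)! : ℝ) = 24 by norm_num [Nat.factorial], div_le_iff₀ (by norm_num)] at this
    linarith
  have h6 : s ^ 6 ≤ 720 * Real.exp s := by
    have := Real.pow_div_factorial_le_exp s hs 6
    rw [show ((6 : ℕ)! : ℝ) = 720 by norm_num [Nat.factorial], div_le_iff₀ (by norm_num)] at this
    linarith
  have e : (1 + s ^ 2) ^ 3 = 1 + 3 * s ^ 2 + 3 * s ^ 4 + s ^ 6 := by ring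
  rw [e]; linarith

/-- Quadratic growth bound for `‖q₁ c w‖`. -/
theorem norm_q₁_le (c : ℝ) (w : ℂ) :
    ‖q₁ c w‖ ≤ (1 + ‖(2 * (c : ℂ) + 20)‖ + ‖((c : ℂ) ^ 2 + 12 * c + 120)‖) * (1 + ‖w‖) ^ 2 := by
  have hw : 0 ≤ ‖w‖ := norm_nonneg w
  have hA : 0 ≤ ‖(2 * (c : ℂ) + 20)‖ := norm_nonneg _
  have hB : 0 ≤ ‖((c : ℂ) ^ 2 + 12 * c + 120)‖ := norm_nonneg _
  have h1 : ‖q₁ c w‖ ≤ ‖w‖ ^ 2 + ‖(2 * (c : ℂ) + 20)‖ * ‖w‖ + ‖((c : ℂ) ^ 2 + 12 * c + 120)‖ := by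
    unfold q₁
    calc ‖w ^ 2 + (2 * (c : ℂ) + 20) * w + ((c : ℂ) ^ 2 + 12 * c + 120)‖
        ≤ ‖w ^ 2 + (2 * (c : ℂ) + 20) * w‖ + ‖((c : ℂ) ^ 2 + 12 * c + 120)‖ := norm_add_le _ _
      _ ≤ ‖w ^ 2‖ + ‖(2 * (c : ℂ) + 20) * w‖ + ‖((c : ℂ) ^ 2 + 12 * c + 120)‖ := by
          gcongr; exact norm_add_le _ _
      _ = ‖w‖ ^ 2 + ‖(2 * (c : ℂ) + 20)‖ * ‖w‖ + ‖((c : ℂ) ^ 2 + 12 * c + 120)‖ := by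
          rw [norm_pow, norm_mul]
  nlinarith [h1, mul_nonneg hA hw, mul_nonneg hB hw, mul_nonneg hA (mul_nonneg hw hw),
    mul_nonneg hB (mul_nonneg hw hw), hw]

/-- Quadratic growth bound for `‖q₂ c w‖`. -/
theorem norm_q₂_le (c : ℝ) (w : ℂ) :
    ‖q₂ c w‖ ≤ (5 + ‖(6 * (c : ℂ) + 60)‖ + ‖((c : ℂ) ^ 2 + 12 * c + 120)‖) * (1 + ‖w‖) ^ 2 := by
  have hw : 0 ≤ ‖w‖ := norm_nonneg w
  have hA : 0 ≤ ‖(6 * (c : ℂ) + 60)‖ := norm_nonneg _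
  have hB : 0 ≤ ‖((c : ℂ) ^ 2 + 12 * c + 120)‖ := norm_nonneg _
  have h1 : ‖q₂ c w‖ ≤ 5 * ‖w‖ ^ 2 + ‖(6 * (c : ℂ) + 60)‖ * ‖w‖ + ‖((c : ℂ) ^ 2 + 12 * c + 120)‖ := by
    unfold q₂
    calc ‖5 * w ^ 2 + (6 * (c : ℂ) + 60) * w + ((c : ℂ) ^ 2 + 12 * c + 120)‖
        ≤ ‖5 * w ^ 2 + (6 * (c : ℂ) + 60) * w‖ + ‖((c : ℂ) ^ 2 + 12 * c + 120)‖ := norm_add_le _ _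
      _ ≤ ‖5 * w ^ 2‖ + ‖(6 * (c : ℂ) + 60) * w‖ + ‖((c : ℂ) ^ 2 + 12 * c + 120)‖ := by
          gcongr; exact norm_add_le _ _
      _ = 5 * ‖w‖ ^ 2 + ‖(6 * (c : ℂ) + 60)‖ * ‖w‖ + ‖((c : ℂ) ^ 2 + 12 * c + 120)‖ := by
          rw [norm_mul, norm_pow, norm_mul, Complex.norm_ofNat]
  nlinarith [h1, mul_nonneg hA hw, mul_nonneg hB hw, mul_nonneg hA (mul_nonneg hw hw),
    mul_nonneg hB (mul_nonneg hw hw), hw]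

/-- Growth of `G`: `‖G(w)‖ ≤ A · exp(‖w‖^{3/4})` for an explicit `A ≥ 0`. -/
theorem exists_norm_G_le (c K : ℝ) :
    ∃ A : ℝ, 0 ≤ A ∧ ∀ w : ℂ, ‖G c K w‖ ≤ A * Real.exp (‖w‖ ^ (3 / 4 : ℝ)) := by
  obtain ⟨A₁, hA₁⟩ : ∃ A₁ : ℝ, A₁ = 1 + ‖(2 * (c : ℂ) + 20)‖ + ‖((c : ℂ) ^ 2 + 12 * c + 120)‖ := ⟨_, rfl⟩
  obtain ⟨A₂, hA₂⟩ : ∃ A₂ : ℝ, A₂ = 5 + ‖(6 * (c : ℂ) + 60)‖ + ‖((c : ℂ) ^ 2 + 12 * c + 120)‖ := ⟨_, rfl⟩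
  have hA₁0 : 0 ≤ A₁ := by rw [hA₁]; positivity
  have hA₂0 : 0 ≤ A₂ := by rw [hA₂]; positivity
  obtain ⟨B, hB⟩ : ∃ B : ℝ, B = 4 * Real.exp 1 * A₁ + 2 * A₂ := ⟨_, rfl⟩
  have hB0 : 0 ≤ B := by rw [hB]; positivity
  refine ⟨(|K| + 799 * B) * Real.exp 8, by positivity, fun w ↦ ?_⟩
  obtain ⟨s, hs⟩ : ∃ s : ℝ, s = ‖w‖ ^ (1 / 2 : ℝ) := ⟨_, rfl⟩
  have hs0 : 0 ≤ s := by rw [hs]; exact Real.rpow_nonneg (norm_nonneg w) _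
  have hx : ‖w‖ = s ^ 2 := by
    rw [hs, ← Real.rpow_natCast, ← Real.rpow_mul (norm_nonneg w)]; norm_num
  obtain ⟨E, hE⟩ : ∃ E : ℝ, E = Real.exp s := ⟨_, rfl⟩
  have hE0 : 0 < E := by rw [hE]; exact Real.exp_pos s
  have hE1 : 1 ≤ E := by rw [hE]; exact Real.one_le_exp hs0
  have hC : ‖coshSqrt w‖ ≤ E := by rw [hE, hs]; exact norm_coshSqrt_le w
  have hD : ‖deriv coshSqrt w‖ ≤ Real.exp 1 * E := by rw [hE, hs]; exact norm_deriv_coshSqrt_le w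
  obtain ⟨M, hM⟩ : ∃ M : ℝ, M = 1 + ‖w‖ := ⟨_, rfl⟩
  have hM1 : 1 ≤ M := by rw [hM]; linarith [norm_nonneg w]
  have hwM : ‖w‖ ≤ M := by rw [hM]; linarith [norm_nonneg w]
  have hM0 : 0 ≤ M := by linarith
  have hq1 : ‖q₁ c w‖ ≤ A₁ * M ^ 2 := by rw [hA₁, hM]; exact norm_q₁_le c w
  have hq2 : ‖q₂ c w‖ ≤ A₂ * M ^ 2 := by rw [hA₂, hM]; exact norm_q₂_le c w
  have hM3 : M ^ 3 ≤ 799 * E := by rw [hM, hx, hE]; exact cube_le_exp hs0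
  have hM23 : M ^ 2 ≤ M ^ 3 := pow_le_pow_right₀ hM1 (by norm_num)
  have he1 : 0 ≤ Real.exp 1 := (Real.exp_pos 1).le
  have hT1 : ‖4 * w * deriv coshSqrt w * q₁ c w‖ ≤ 4 * Real.exp 1 * A₁ * (M ^ 3 * E) := by
    rw [norm_mul, norm_mul, norm_mul, Complex.norm_ofNat]
    calc 4 * ‖w‖ * ‖deriv coshSqrt w‖ * ‖q₁ c w‖ ≤ 4 * M * (Real.exp 1 * E) * (A₁ * M ^ 2) := by
          gcongr
      _ = 4 * Real.exp 1 * A₁ * (M ^ 3 * E) := by ring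
  have hT2 : ‖2 * coshSqrt w * q₂ c w‖ ≤ 2 * A₂ * (M ^ 3 * E) := by
    rw [norm_mul, norm_mul, Complex.norm_ofNat]
    calc 2 * ‖coshSqrt w‖ * ‖q₂ c w‖ ≤ 2 * E * (A₂ * M ^ 2) := by gcongr
      _ = 2 * A₂ * (M ^ 2 * E) := by ring
      _ ≤ 2 * A₂ * (M ^ 3 * E) := by gcongr
  have hK : ‖(K : ℂ)‖ = |K| := by rw [Complex.norm_real, Real.norm_eq_abs]
  have h1 : ‖G c K w‖ ≤ |K| + B * (M ^ 3 * E) := by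
    unfold G
    calc ‖(K : ℂ) + 4 * w * deriv coshSqrt w * q₁ c w - 2 * coshSqrt w * q₂ c w‖
        ≤ ‖(K : ℂ) + 4 * w * deriv coshSqrt w * q₁ c w‖ + ‖2 * coshSqrt w * q₂ c w‖ := norm_sub_le _ _
      _ ≤ ‖(K : ℂ)‖ + ‖4 * w * deriv coshSqrt w * q₁ c w‖ + ‖2 * coshSqrt w * q₂ c w‖ := by
          gcongr; exact norm_add_le _ _
      _ ≤ |K| + 4 * Real.exp 1 * A₁ * (M ^ 3 * E) + 2 * A₂ * (M ^ 3 * E) := by rw [hK]; gcongr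
      _ = |K| + B * (M ^ 3 * E) := by rw [hB]; ring
  have h2 : M ^ 3 * E ≤ 799 * (E * E) := by
    have := mul_le_mul_of_nonneg_right hM3 hE0.le
    linarith [this]
  have h3 : E * E ≤ Real.exp 8 * Real.exp (‖w‖ ^ (3 / 4 : ℝ)) := by
    rw [hE, ← Real.exp_add, ← Real.exp_add]
    exact Real.exp_le_exp.2 (by have := two_sqrt_le w; rw [← hs] at this; linarith)
  have hEE : 1 ≤ Real.exp 8 * Real.exp (‖w‖ ^ (3 / 4 : ℝ)) :=
    le_trans (one_le_mul_of_one_le_of_one_le hE1 hE1) h3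
  have hK0 : |K| ≤ |K| * (Real.exp 8 * Real.exp (‖w‖ ^ (3 / 4 : ℝ))) :=
    le_mul_of_one_le_right (abs_nonneg K) hEE
  have h23 : M ^ 3 * E ≤ 799 * (Real.exp 8 * Real.exp (‖w‖ ^ (3 / 4 : ℝ))) :=
    h2.trans (mul_le_mul_of_nonneg_left h3 (by norm_num))
  calc ‖G c K w‖ ≤ |K| + B * (M ^ 3 * E) := h1
    _ ≤ |K| * (Real.exp 8 * Real.exp (‖w‖ ^ (3 / 4 : ℝ)))
          + B * (799 * (Real.exp 8 * Real.exp (‖w‖ ^ (3 / 4 : ℝ)))) :=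
        add_le_add hK0 (mul_le_mul_of_nonneg_left h23 hB0)
    _ = (|K| + 799 * B) * Real.exp 8 * Real.exp (‖w‖ ^ (3 / 4 : ℝ)) := by ring

/-- `G` is entire of order `< 1` (the tree's two packagings). -/
theorem isEntireOfOrderLtOne_G (c K : ℝ) : IsEntireOfOrderLtOne (G c K) := by
  obtain ⟨A, -, hA⟩ := exists_norm_G_le c K
  exact ⟨differentiable_G c K, 3 / 4, A, by norm_num, hA⟩

/-- `G c K` is entire of order `< 1` (`IsEntireOfOrderLt 1` form). -/
theorem isEntireOfOrderLt_one_G (c K : ℝ) : IsEntireOfOrderLt 1 (G c K) := by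
  obtain ⟨A, -, hA⟩ := exists_norm_G_le c K
  exact ⟨differentiable_G c K, 3 / 4, A, by norm_num, hA⟩

end Summit.RiemannHypothesis.RiemannHypothesis.Theorems.Splittings.JensenDegenerateCritical
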